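import Summits.BirchSwinnertonDyer.BirchSwinnertonDyer.Theorems.DerivedKatoValuationDoorDerivedKatoDoorStubDepthLeQuotientLength
import Summits.BirchSwinnertonDyer.BirchSwinnertonDyer.Theorems.DerivedKatoValuationDoorDerivedKatoDoorStubQuotientLengthLeFineLength
import HarnessLib

/-!
# Standalone split glue for the deciding crux `DerivedKatoDoor` (route `DerivedKatoValuationDoor`, stmt-BirchSwinnertonDyer-23024)

STANDALONE module: it does NOT import the route file `Theses/DerivedKatoValuationDoor.lean`, so the gate can cite
its theorem as `--glue-by` inside that file without a cyclic import (`glue.cyclic-import` refused the sibling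
module `DerivedKatoValuationDoorDerivedKatoDoorSplit.lean`, p660891, whose theorem `derivedKatoDoor_of_subs` is
stated over the route decls by name; that module is append-only and stays as the by-name helper). Here the three
route statements are SPELLED OUT verbatim — child 1 = `FineLengthLeOneOfAnalyticRankTwo` («a = 2 ⇒
ℓ_T(X₀(E/ℚ_∞)) ≤ 1 at door primes», the LEAD's promoted stub L3 of line `lower`), child 2 =
`KatoMainConjecturePrimeTOfDoor` (the Literature named fact `Kato2004.kato_mainConjecture_primeT_of_door` by name;
nothing asserted), parent = `DerivedKatoDoor` (D-K₂: no rational `T²`-divisibility of an admissible Kato zeta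
class at a door prime of an analytic-rank-two curve). `derivedKatoDoor_of_parts : child₁ → child₂ → parent`,
sorry-free over LANDED theorems only: `Theorems.stub_depthLeQuotientLength` (p656388: `p^m z₀ = T^k h`, `z₀ ≠ 0` ⇒
`k ≤ ℓ_T(𝐇¹/Λz₀)`) and `Theorems.DerivedKatoValuationDoor.stub_quotientLengthLeFineLength_of_fact` (w2: under the
fact, `z₀ ≠ 0 ∧ ℓ_T(𝐇¹/Λz₀) ≤ ℓ_T(X₀)`). The composition is the LEAD's `DerivedKatoDoor_of` of
`Cruxes/DerivedKatoDoor/Lines/lower.lean` with the two open stubs as hypotheses: `2 ≤ ℓ_T(𝐇¹/Λz₀) ≤ ℓ_T(X₀) ≤ 1`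
in `ℕ∞` is absurd. Tenure planner plancard-bsd-s0-dkdoor g3. BSD is not proved by any of this.
[cite: Kato2004Asterisque, Conj. 12.10 (p. 224), Thm. 12.4 (2) (p. 221)] [cite: BurungaleCastellaSkinner2025, Thm. 1.1.2 (a)]
-/

namespace Summit.BirchSwinnertonDyer.BirchSwinnertonDyer.Theorems.DerivedKatoValuationDoor

/-- **Split glue `DerivedKatoDoor ⇐ FineLengthLeOneOfAnalyticRankTwo ∧ KatoMainConjecturePrimeTOfDoor`**, all three
statements spelled out verbatim (no import of the route file). At a door prime of an analytic-rank-two globally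
minimal curve, a rational `T²`-divisibility `p^m z₀ = T² h` of an admissible Kato zeta class would give
`2 ≤ ℓ_T(𝐇¹/Λz₀)` (landed depth lemma, `z₀ ≠ 0`), `≤ ℓ_T(X₀(E/ℚ_∞))` (Kato Conj. 12.10 at `(T)` at door
primes — the print fact, hypothesis `hIMC`), `≤ 1` (hypothesis `hFine`): absurd in `ℕ∞`.
[cite: Kato2004Asterisque, Conj. 12.10 (p. 224)] [cite: BurnsKuriharaSano2019, Lemma 6.12] -/
theorem derivedKatoDoor_of_parts
    (hFine : ∀ (W : WeierstrassCurve ℚ) [W.IsElliptic] [W.IsGloballyMinimal] (p : ℕ) [Fact p.Prime] [ContinuousSMul ℤ_[p] (W.tateModule p)], W.analyticRank = 2 → (5 ≤ p ∧ Literature.NumberTheory.EllipticCurves.IsOrdinaryAt W p ∧ W.HasSurjectiveModNGaloisRep p) → ∀ (K : Literature.NumberTheory.EllipticCurves.ZpExtension ℚ p), K.IsCyclotomic → ∀ (γ : Field.absoluteGaloisGroup ℚ) (hγ : K.IsTopGenerator γ), Literature.NumberTheory.EllipticCurves.Module.lengthAt (Literature.NumberTheory.EllipticCurves.IwasawaAlgebra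 p) (W.fineSelmerDualData K hγ).X (Literature.NumberTheory.EllipticCurves.IwasawaAlgebra.primeT p) ≤ 1)
    (hIMC : Literature.NumberTheory.EllipticCurves.Kato2004.kato_mainConjecture_primeT_of_door) :
    ∀ (W : WeierstrassCurve ℚ) [W.IsElliptic] [W.IsGloballyMinimal] (p : ℕ) [Fact p.Prime] [ContinuousSMul ℤ_[p] (W.tateModule p)], W.analyticRank = 2 → (5 ≤ p ∧ Literature.NumberTheory.EllipticCurves.IsOrdinaryAt W p ∧ W.HasSurjectiveModNGaloisRep p) → ∀ (K : Literature.NumberTheory.EllipticCurves.ZpExtension ℚ p) (hK : K.IsCyclotomic) (γ : Field.absoluteGaloisGroup ℚ) (I : Literature.NumberTheory.EllipticCurves.Kato2004.IwasawaH1Data W p K γ) (z₀ : I.H), K.IsTopGenerator γ → Literature.NumberTheory.EllipticCurves.Kato2004.IsAdmissibleZetaClass W p K hK I z₀ → ¬ ∃ (h : I.H) (m : ℕ), ((p : Literature.NumberTheory.EllipticCurves.IwasawaAlgebra p) ^ m) • z₀ = ((PowerSeries.X : Literature.NumberTheory.EllipticCurves.IwasawaAlgebra p) ^ 2) • h :=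 by
  intro W _ _ p _ _ ha hdoor K hK γ I z₀ hγ hz hdiv
  obtain ⟨hne, hle⟩ := stub_quotientLengthLeFineLength_of_fact hIMC W p hdoor K hK γ I z₀ hγ hz
  have h2 :=
    Summit.BirchSwinnertonDyer.BirchSwinnertonDyer.Theorems.stub_depthLeQuotientLength W p K γ I z₀ hγ hne 2 hdiv
  have h1 := hFine W p ha hdoor K hK γ hγ
  have h21 : ((2 : ℕ) : ℕ∞) ≤ 1 := h2.trans (hle.trans h1)
  exact absurd (by exact_mod_cast h21 : (2 : ℕ) ≤ 1) (by omega)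

end Summit.BirchSwinnertonDyer.BirchSwinnertonDyer.Theorems.DerivedKatoValuationDoor
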